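import Summits.HubbardSuperconductivity.HubbardSuperconductivity.Theorems.SsbToEvenTorusLro.Negative.SaturatedFerromagnet

/-!
# `LowEnergyRigidity` (crux stmt-HubbardSuperconductivity-1892, route `DeformationLadder`):
# a saturated ferromagnet inside the energy window kills the rigidity matrix — witnesses must
# EXCLUDE Nagaoka ferromagnetism from their `κ`-window (negative-side support, refuter seat)

`LowEnergyRigidity` claims: `∃ U>0, δ∈(0,½), κ>0, a>0, L₀, ∀ even L ≥ L₀`, every unit vector `φ` of
`szSector N_L 0` (`N_L = 2⌊(1-δ)L²/2⌋`) with `Re⟨φ, H_L φ⟩ ≤ minEnergyOn H_L (szSector N_L 0) + κ`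
(`H_L = hubbardTorus 2 L 1 U`) has `a ≤ L⁻⁴ Re⟨φ, Δ_dᴴΔ_d φ⟩`.

A second family of exact KERNEL states of `Δ_d` inside the sector, this time with a physically
meaningful energy (statements inline; no proposition is defined under `Summits/`):

* `lowEnergyRigidity_matrix_false_of_ferromagnet_in_window` — at one side `L` and one sector
  `(2n, S^z = 0)`, `2n ≤ L²`: if the FULLY POLARISED sector `(2n, S^z = n)` (a free spinless band;
  it "does not feel `U`") comes within `κ` of the `(2n, 0)` sector energy,
  `E_min(2n, n) ≤ E_min(2n, 0) + κ`, then the rigidity matrix with window `κ` fails for every order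
  `a > 0`. Witness: the `(S⁻)ⁿ`-descendant of a top-sector ground state
  (`SsbToEvenTorusLro.Negative.saturated_descendant`) is a unit vector of `szSector (2n) 0`, an
  `H`-eigenvector of energy `E_min(2n, n) ≤ E₀ + κ` (inside the window), of maximal total spin, hence
  annihilated by the singlet pair field (`NoGo.pairField_mulVec_eq_zero_of_saturated`, Tasaki 1998
  p. 20): LRO exactly `0`.
* `lowEnergyRigidity_false_at_of_frequently_ferromagnet_in_window` — hence at any `(U, δ, κ)`,
  `δ ≥ 0`, for which the saturated ferromagnet enters the `κ`-window at infinitely many even sides,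
  NO `(a, L₀)` completes a witness.

Moral for provers: a witness `(U, δ, κ, a, L₀)` of the crux CERTIFIES, as a by-product, that along
all large even tori the saturated (Nagaoka) ferromagnet stays more than `κ` above the
`(N_L, S^z = 0)` ground energy — the chosen `(U, δ)` must lie outside every Nagaoka-type corner in
this quantitative sense (open at positive hole density for every finite `U`: Tasaki, Prog. Theor.
Phys. 99 (1998) 489, §4.4; excluded for small `U` on finite lattices, ibid. Thm 3.2). This file does
NOT refute the crux.

References: H. Tasaki, Prog. Theor. Phys. 99 (1998) 489, §3.2–3.3, §4.4, p. 20; E. H. Lieb,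
PRL 62 (1989) 1201 (sectors, `SU(2)` descent); the tree's `SaturatedFerromagnet` (crux
`SsbToEvenTorusLro`) and `NoGoNogoSingletPairKillsSaturatedFM`.
-/

noncomputable section

set_option linter.dupNamespace false

namespace Summit.HubbardSuperconductivity.HubbardSuperconductivity.Theorems.LowEnergyRigidity.Negative

open Literature.MathematicalPhysics.QuantumLattice Literature.Barriers.HubbardSuperconductivity
open Literature.Probability.LatticeModels
open Matrix HubbardWave0
open Summit.HubbardSuperconductivity.HubbardSuperconductivity.Theorems.SsbToEvenTorusLro.Negative
open scoped ComplexOrder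

/-- **A saturated ferromagnet inside the window kills the rigidity matrix.** At a side `L`, a
coupling `U`, a sector `(2n, S^z = 0)` with `2n ≤ L²`, a window `κ` and any order `a > 0`: if the
fully polarised sector energy satisfies `E_min(2n, S^z = n) ≤ E_min(2n, S^z = 0) + κ`, then NOT every
unit vector of `szSector (2n) 0` within `κ` of the sector energy has `d`-wave LRO density `≥ a` —
the `S^z = 0` member of the saturated multiplet at energy `E_min(2n, n)` is in the window and is
annihilated by `Δ_d`. Tasaki, Prog. Theor. Phys. 99 (1998) 489, p. 20 and §3.2; Lieb (1989). [folklore] -/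
theorem lowEnergyRigidity_matrix_false_of_ferromagnet_in_window (L : ℕ) [NeZero L] (U : ℝ) {n : ℕ}
    (hn : 2 * n ≤ L ^ 2) {κ a : ℝ} (ha : 0 < a)
    (hFM : (hubbardTorus 2 L 1 U).minEnergyOn (szSector (2 * n) (((2 * n : ℕ) : ℝ) / 2)) ≤
      (hubbardTorus 2 L 1 U).minEnergyOn (szSector (2 * n) 0) + κ) :
    ¬ ∀ φ : Fock (Orb (FermionTorus 2 L)), φ ∈ szSector (2 * n) 0 → star φ ⬝ᵥ φ = 1 →
        (star φ ⬝ᵥ Matrix.mulVec (hubbardTorus 2 L 1 U) φ).re ≤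
          (hubbardTorus 2 L 1 U).minEnergyOn (szSector (2 * n) 0) + κ →
        a ≤ (expect ((pairField dWaveFormFactor L)ᴴ * pairField dWaveFormFactor L) φ).re /
          (L : ℝ) ^ 4 := by
  intro h
  set H := hubbardTorus 2 L 1 U with hH
  -- a top-sector ground state and its `(S⁻)ⁿ`-descendant in the `S^z = 0` sector
  obtain ⟨φ, -, hφ⟩ := exists_unit_isGroundStateInSector_top U L (2 * n) hn
  have hsec : IsInSector (2 * n) 0 φ := (mem_szSector_top_iff _ _).1 hφ.1
  have hc : Commute H Literature.MathematicalPhysics.QuantumLattice.spinMinus :=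
    LiebThm1.hamiltonian_commute_spinMinus (fermionTorusGraph 2 L) 1 U
  obtain ⟨w, hw, hw0, hHw, hSw⟩ := saturated_descendant H hc hsec hφ.2.1 hφ.2.2
  obtain ⟨c, hc0, hc1⟩ := exists_smul_unit hw0
  have hψS : c • w ∈ szSector (Λ := FermionTorus 2 L) (2 * n) 0 :=
    Submodule.smul_mem _ c ((mem_szSector_two_mul_zero_iff n w).2 hw)
  have hHψ : H *ᵥ (c • w) =
      (((hubbardTorus 2 L 1 U).minEnergyOn (szSector (2 * n) (((2 * n : ℕ) : ℝ) / 2)) : ℝ) : ℂ) •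
        (c • w) := by
    rw [mulVec_smul, hHw, smul_comm]
  -- it sits in the window
  have hwin : (star (c • w) ⬝ᵥ Matrix.mulVec (hubbardTorus 2 L 1 U) (c • w)).re ≤
      (hubbardTorus 2 L 1 U).minEnergyOn (szSector (2 * n) 0) + κ := by
    rw [← hH, hHψ, dotProduct_smul, hc1, smul_eq_mul, mul_one, Complex.ofReal_re]
    exact hFM
  have hLRO := h (c • w) hψS hc1 hwin
  -- and is annihilated by the singlet pair field (maximal total spin)
  have hN : IsNParticle (2 * n) (c • w) := ((mem_szSector_iff _ _ _).1 hψS).1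
  have hS : spinSq *ᵥ (c • w) =
      ((((2 * n : ℕ) : ℝ) / 2 * ((((2 * n : ℕ) : ℝ) / 2) + 1) : ℝ) : ℂ) • (c • w) := by
    rw [mulVec_smul, hSw, smul_comm]
    congr 2
    push_cast
    ring
  have hzero : pairField dWaveFormFactor L *ᵥ (c • w) = 0 :=
    Summit.HubbardSuperconductivity.NoGo.pairField_mulVec_eq_zero_of_saturated dWaveFormFactor L hN hS
  have hexp : expect ((pairField dWaveFormFactor L)ᴴ * pairField dWaveFormFactor L) (c • w) = 0 := by
    simp only [Literature.MathematicalPhysics.QuantumLattice.expect]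
    rw [← mulVec_mulVec, hzero, mulVec_zero, dotProduct_zero]
  rw [hexp, Complex.zero_re, zero_div] at hLRO
  exact absurd hLRO (not_le.2 ha)

/-- **Frequent ferromagnetism in the window excludes every witness at `(U, δ, κ)`** (`δ ≥ 0`): if at
infinitely many even sides the fully polarised sector `(N_L, N_L/2)` of `hubbardTorus 2 L 1 U` comes
within `κ` of the `(N_L, 0)` sector energy, `N_L = 2⌊(1-δ)L²/2⌋`, then no order `a > 0` and no
`L₀` complete `(U, δ, κ)` to a witness of the `LowEnergyRigidity` matrix. Contrapositive (the
prover's reading): a witness certifies `E_min(N_L, N_L/2) > E_min(N_L, 0) + κ` at all large even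
`L` — saturated ferromagnetism is excluded from the window. Tasaki (1998) §3.2, §4.4. [folklore] -/
theorem lowEnergyRigidity_false_at_of_frequently_ferromagnet_in_window {U δ κ : ℝ} (hδ : 0 ≤ δ)
    (hFM : ∀ L₀ : ℕ, ∃ L : ℕ, L₀ ≤ L ∧ Even L ∧
      (hubbardTorus 2 L 1 U).minEnergyOn (szSector (2 * ⌊(1 - δ) * (L : ℝ) ^ 2 / 2⌋₊)
          (((2 * ⌊(1 - δ) * (L : ℝ) ^ 2 / 2⌋₊ : ℕ) : ℝ) / 2)) ≤
        (hubbardTorus 2 L 1 U).minEnergyOn (szSector (2 * ⌊(1 - δ) * (L : ℝ) ^ 2 / 2⌋₊) 0) + κ) :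
    ¬ ∃ a : ℝ, 0 < a ∧ ∃ L₀ : ℕ, ∀ (L : ℕ) [NeZero L], L₀ ≤ L → Even L →
      ∀ φ : Fock (Orb (FermionTorus 2 L)),
        φ ∈ szSector (2 * ⌊(1 - δ) * (L : ℝ) ^ 2 / 2⌋₊) 0 → star φ ⬝ᵥ φ = 1 →
        (star φ ⬝ᵥ Matrix.mulVec (hubbardTorus 2 L 1 U) φ).re ≤
          (hubbardTorus 2 L 1 U).minEnergyOn (szSector (2 * ⌊(1 - δ) * (L : ℝ) ^ 2 / 2⌋₊) 0) + κ →
        a ≤ (expect ((pairField dWaveFormFactor L)ᴴ * pairField dWaveFormFactor L) φ).re /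
          (L : ℝ) ^ 4 := by
  rintro ⟨a, ha, L₀, h⟩
  obtain ⟨L, hL, hev, hwin⟩ := hFM (L₀ + 1)
  haveI : NeZero L := ⟨by omega⟩
  exact lowEnergyRigidity_matrix_false_of_ferromagnet_in_window L U (two_mul_natFloor_le_sq hδ L) ha
    hwin (h L (by omega) hev)

end Summit.HubbardSuperconductivity.HubbardSuperconductivity.Theorems.LowEnergyRigidity.Negative

end
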